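import Mathlib
import HarnessLib
import Literature.MathematicalPhysics.QuantumLattice.KohnLuttingerRadialProjection

/-!
# Angle harmonics are channel functions (crux `CwKLChiralWindow`, line Sketch)

With the polar angle `arg k := Complex.arg (k₀ + i k₁)` of a momentum `k ≠ 0` (and the value `0` at
the origin, where the angle is degenerate), the harmonics `cos (j · arg k)`, `sin (j · arg k)` transform
in the one-dimensional irreps of `D₄` according to `j mod 4`, and the odd ones lie in `E`:

* `kl_hc_inChannel_linear` — the isotypic projection `d4Project χ` is linear, so channels are closed
  under linear combinations;
* `kl_hc_arg_rot`, `kl_hc_arg_refl`, `kl_hc_arg_neg` — `arg (rot k) ≡ arg k + π/2`,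
  `arg (refl k) ≡ -arg k`, `arg (-k) ≡ arg k + π` in `ℝ/2πℤ`;
* `kl_hc_inChannel_A1g_of`, `…_A2g_of`, `…_B1g_of`, `…_B2g_of` — membership in the one-dimensional
  channels from the parities under the quarter turn and the axis reflection;
* `stub_klHarmonicChannel` — the registered statement.

Everything is proved; no definitions. [folklore]
-/

noncomputable section

set_option linter.dupNamespace false

namespace Summit.HubbardSuperconductivity.HubbardSuperconductivity.Theorems

open MeasureTheory Literature.MathematicalPhysics.QuantumLattice

/-! ### Linearity of the channels -/

/-- The isotypic projection is additive. [folklore] -/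
theorem kl_hc_d4Project_add (χ : D4Irrep) (f g : Momentum → ℝ) (k : Momentum) :
    d4Project χ (fun q => f q + g q) k = d4Project χ f k + d4Project χ g k := by
  unfold d4Project
  rw [← mul_add, ← Finset.sum_add_distrib]
  congr 1
  exact Finset.sum_congr rfl fun γ _ => by ring

/-- **Channels are linear**: if `f, g` lie in the channel `χ` then so does `a f + b g`. [folklore] -/
theorem kl_hc_inChannel_linear (χ : D4Irrep) (f g : Momentum → ℝ) (a b : ℝ) (hf : InChannel χ f)
    (hg : InChannel χ g) : InChannel χ (fun k => a * f k + b * g k) := by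
  unfold InChannel at hf hg ⊢
  funext k
  have h := kl_hc_d4Project_add χ (fun q => a * f q) (fun q => b * g q) k
  rw [d4Project_const_mul, d4Project_const_mul, hf, hg] at h
  exact h

/-! ### One-dimensional channels from the parities under `rot` and `refl` -/

/-- A function that is even under the quarter turn and even under the axis reflection is `A₁g`.
[folklore] -/
theorem kl_hc_inChannel_A1g_of {ψ : Momentum → ℝ} (hrot : ∀ k, ψ (rotMomentum k) = ψ k)
    (hrefl : ∀ k, ψ (reflMomentum k) = ψ k) : InChannel .A1g ψ := by
  funext k
  simp only [d4Project, sum_dihedralGroup_four, d4Momentum_r_zero, d4Momentum_r_one, d4Momentum_r_two,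
    d4Momentum_r_three, d4Momentum_sr_zero, d4Momentum_sr_one, d4Momentum_sr_two, d4Momentum_sr_three,
    D4Irrep.char, D4Irrep.dim, hrot, hrefl]
  ring

/-- A function that is even under the quarter turn and odd under the axis reflection is `A₂g`.
[folklore] -/
theorem kl_hc_inChannel_A2g_of {ψ : Momentum → ℝ} (hrot : ∀ k, ψ (rotMomentum k) = ψ k)
    (hrefl : ∀ k, ψ (reflMomentum k) = -ψ k) : InChannel .A2g ψ := by
  funext k
  simp only [d4Project, sum_dihedralGroup_four, d4Momentum_r_zero, d4Momentum_r_one, d4Momentum_r_two,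
    d4Momentum_r_three, d4Momentum_sr_zero, d4Momentum_sr_one, d4Momentum_sr_two, d4Momentum_sr_three,
    D4Irrep.char, D4Irrep.dim, hrot, hrefl]
  ring

/-- A function that is odd under the quarter turn and even under the axis reflection is `B₁g`.
[folklore] -/
theorem kl_hc_inChannel_B1g_of {ψ : Momentum → ℝ} (hrot : ∀ k, ψ (rotMomentum k) = -ψ k)
    (hrefl : ∀ k, ψ (reflMomentum k) = ψ k) : InChannel .B1g ψ := by
  funext k
  simp only [d4Project, sum_dihedralGroup_four, d4Momentum_r_zero, d4Momentum_r_one, d4Momentum_r_two,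
    d4Momentum_r_three, d4Momentum_sr_zero, d4Momentum_sr_one, d4Momentum_sr_two, d4Momentum_sr_three,
    D4Irrep.char, D4Irrep.dim, zmod_four_val.1, zmod_four_val.2.1, zmod_four_val.2.2.1,
    zmod_four_val.2.2.2, hrot, hrefl, neg_neg]
  ring

/-- A function that is odd under the quarter turn and odd under the axis reflection is `B₂g`.
[folklore] -/
theorem kl_hc_inChannel_B2g_of {ψ : Momentum → ℝ} (hrot : ∀ k, ψ (rotMomentum k) = -ψ k)
    (hrefl : ∀ k, ψ (reflMomentum k) = -ψ k) : InChannel .B2g ψ := by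
  funext k
  simp only [d4Project, sum_dihedralGroup_four, d4Momentum_r_zero, d4Momentum_r_one, d4Momentum_r_two,
    d4Momentum_r_three, d4Momentum_sr_zero, d4Momentum_sr_one, d4Momentum_sr_two, d4Momentum_sr_three,
    D4Irrep.char, D4Irrep.dim, zmod_four_val.1, zmod_four_val.2.1, zmod_four_val.2.2.1,
    zmod_four_val.2.2.2, hrot, hrefl, neg_neg]
  ring

/-! ### Integer-frequency harmonics factor through the angle `ℝ/2πℤ` -/

/-- `cos (n θ)` only depends on `θ mod 2π`. [folklore] -/
theorem kl_hc_cos_nat_mul (n : ℕ) (θ : ℝ) : Real.cos (n * θ) = Real.Angle.cos (n • (θ : Real.Angle)) := by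
  rw [← Real.Angle.natCast_mul_eq_nsmul, Real.Angle.cos_coe]

/-- `sin (n θ)` only depends on `θ mod 2π`. [folklore] -/
theorem kl_hc_sin_nat_mul (n : ℕ) (θ : ℝ) : Real.sin (n * θ) = Real.Angle.sin (n • (θ : Real.Angle)) := by
  rw [← Real.Angle.natCast_mul_eq_nsmul, Real.Angle.sin_coe]

/-- `j · (π/2) ≡ 0 (mod 2π)` for `4 ∣ j`. [folklore] -/
theorem kl_hc_nsmul_pi_div_two_of_mod_zero {j : ℕ} (hj : j % 4 = 0) :
    j • ((Real.pi / 2 : ℝ) : Real.Angle) = 0 := by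
  obtain ⟨m, rfl⟩ : ∃ m, j = 4 * m := ⟨j / 4, by omega⟩
  rw [← Real.Angle.natCast_mul_eq_nsmul, ← Real.Angle.coe_zero, Real.Angle.angle_eq_iff_two_pi_dvd_sub]
  exact ⟨m, by push_cast; ring⟩

/-- `j · (π/2) ≡ π (mod 2π)` for `j ≡ 2 (4)`. [folklore] -/
theorem kl_hc_nsmul_pi_div_two_of_mod_two {j : ℕ} (hj : j % 4 = 2) :
    j • ((Real.pi / 2 : ℝ) : Real.Angle) = Real.pi := by
  obtain ⟨m, rfl⟩ : ∃ m, j = 4 * m + 2 := ⟨j / 4, by omega⟩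
  rw [← Real.Angle.natCast_mul_eq_nsmul, Real.Angle.angle_eq_iff_two_pi_dvd_sub]
  exact ⟨m, by push_cast; ring⟩

/-- `j · π ≡ π (mod 2π)` for odd `j`. [folklore] -/
theorem kl_hc_nsmul_pi_of_odd {j : ℕ} (hj : j % 2 = 1) :
    j • ((Real.pi : ℝ) : Real.Angle) = Real.pi := by
  obtain ⟨m, rfl⟩ : ∃ m, j = 2 * m + 1 := ⟨j / 2, by omega⟩
  rw [← Real.Angle.natCast_mul_eq_nsmul, Real.Angle.angle_eq_iff_two_pi_dvd_sub]
  exact ⟨m, by push_cast; ring⟩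

/-! ### The angle of a momentum under the point group -/

/-- `arg (rot k) ≡ arg k + π/2 (mod 2π)` for `k ≠ 0`. [folklore] -/
theorem kl_hc_arg_rot {k : Momentum} (hk : k ≠ 0) :
    ((Complex.arg ⟨rotMomentum k 0, rotMomentum k 1⟩ : ℝ) : Real.Angle) =
      (Complex.arg ⟨k 0, k 1⟩ : Real.Angle) + ((Real.pi / 2 : ℝ) : Real.Angle) := by
  rw [complex_mk_rotMomentum, Complex.arg_mul_coe_angle Complex.I_ne_zero (complex_mk_ne_zero hk),
    Complex.arg_I, add_comm]

/-- `arg (refl k) ≡ -arg k (mod 2π)`. [folklore] -/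
theorem kl_hc_arg_refl (k : Momentum) :
    ((Complex.arg ⟨reflMomentum k 0, reflMomentum k 1⟩ : ℝ) : Real.Angle) =
      -(Complex.arg ⟨k 0, k 1⟩ : Real.Angle) := by
  rw [complex_mk_reflMomentum, Complex.arg_conj_coe_angle]

/-- `z(-k) = -z(k)`. [folklore] -/
theorem kl_hc_complex_mk_neg (k : Momentum) : (⟨(-k) 0, (-k) 1⟩ : ℂ) = -⟨k 0, k 1⟩ := by
  apply Complex.ext <;> simp

/-- `arg (-k) ≡ arg k + π (mod 2π)` for `k ≠ 0`. [folklore] -/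
theorem kl_hc_arg_neg {k : Momentum} (hk : k ≠ 0) :
    ((Complex.arg ⟨(-k) 0, (-k) 1⟩ : ℝ) : Real.Angle) =
      (Complex.arg ⟨k 0, k 1⟩ : Real.Angle) + ((Real.pi : ℝ) : Real.Angle) := by
  rw [kl_hc_complex_mk_neg, Complex.arg_neg_coe_angle (complex_mk_ne_zero hk)]

/-- The quarter turn fixes the origin. [folklore] -/
theorem kl_hc_rot_zero : rotMomentum (0 : Momentum) = 0 := d4Momentum_zero (DihedralGroup.r 1)

/-- The axis reflection fixes the origin. [folklore] -/
theorem kl_hc_refl_zero : reflMomentum (0 : Momentum) = 0 := d4Momentum_zero (DihedralGroup.sr 0)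

/-! ### Parities of the harmonics -/

/-- `cos (j · arg)` is invariant under the quarter turn for `4 ∣ j`. [folklore] -/
theorem kl_hc_cos_rot_mod_zero {j : ℕ} (hj : j % 4 = 0) (k : Momentum) :
    (if rotMomentum k = 0 then (0 : ℝ) else Real.cos (j * Complex.arg ⟨rotMomentum k 0, rotMomentum k 1⟩)) =
      if k = 0 then (0 : ℝ) else Real.cos (j * Complex.arg ⟨k 0, k 1⟩) := by
  by_cases hk : k = 0
  · subst hk; simp [kl_hc_rot_zero]
  · rw [if_neg (rotMomentum_ne_zero hk), if_neg hk, kl_hc_cos_nat_mul, kl_hc_cos_nat_mul, kl_hc_arg_rot hk,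
      nsmul_add, kl_hc_nsmul_pi_div_two_of_mod_zero hj, add_zero]

/-- `sin (j · arg)` is invariant under the quarter turn for `4 ∣ j`. [folklore] -/
theorem kl_hc_sin_rot_mod_zero {j : ℕ} (hj : j % 4 = 0) (k : Momentum) :
    (if rotMomentum k = 0 then (0 : ℝ) else Real.sin (j * Complex.arg ⟨rotMomentum k 0, rotMomentum k 1⟩)) =
      if k = 0 then (0 : ℝ) else Real.sin (j * Complex.arg ⟨k 0, k 1⟩) := by
  by_cases hk : k = 0
  · subst hk; simp [kl_hc_rot_zero]
  · rw [if_neg (rotMomentum_ne_zero hk), if_neg hk, kl_hc_sin_nat_mul, kl_hc_sin_nat_mul, kl_hc_arg_rot hk,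
      nsmul_add, kl_hc_nsmul_pi_div_two_of_mod_zero hj, add_zero]

/-- `cos (j · arg)` is odd under the quarter turn for `j ≡ 2 (4)`. [folklore] -/
theorem kl_hc_cos_rot_mod_two {j : ℕ} (hj : j % 4 = 2) (k : Momentum) :
    (if rotMomentum k = 0 then (0 : ℝ) else Real.cos (j * Complex.arg ⟨rotMomentum k 0, rotMomentum k 1⟩)) =
      -(if k = 0 then (0 : ℝ) else Real.cos (j * Complex.arg ⟨k 0, k 1⟩)) := by
  by_cases hk : k = 0
  · subst hk; simp [kl_hc_rot_zero]
  · rw [if_neg (rotMomentum_ne_zero hk), if_neg hk, kl_hc_cos_nat_mul, kl_hc_cos_nat_mul, kl_hc_arg_rot hk,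
      nsmul_add, kl_hc_nsmul_pi_div_two_of_mod_two hj, Real.Angle.cos_add_pi]

/-- `sin (j · arg)` is odd under the quarter turn for `j ≡ 2 (4)`. [folklore] -/
theorem kl_hc_sin_rot_mod_two {j : ℕ} (hj : j % 4 = 2) (k : Momentum) :
    (if rotMomentum k = 0 then (0 : ℝ) else Real.sin (j * Complex.arg ⟨rotMomentum k 0, rotMomentum k 1⟩)) =
      -(if k = 0 then (0 : ℝ) else Real.sin (j * Complex.arg ⟨k 0, k 1⟩)) := by
  by_cases hk : k = 0
  · subst hk; simp [kl_hc_rot_zero]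
  · rw [if_neg (rotMomentum_ne_zero hk), if_neg hk, kl_hc_sin_nat_mul, kl_hc_sin_nat_mul, kl_hc_arg_rot hk,
      nsmul_add, kl_hc_nsmul_pi_div_two_of_mod_two hj, Real.Angle.sin_add_pi]

/-- `cos (j · arg)` is even under the axis reflection. [folklore] -/
theorem kl_hc_cos_refl (j : ℕ) (k : Momentum) :
    (if reflMomentum k = 0 then (0 : ℝ) else Real.cos (j * Complex.arg ⟨reflMomentum k 0, reflMomentum k 1⟩)) =
      if k = 0 then (0 : ℝ) else Real.cos (j * Complex.arg ⟨k 0, k 1⟩) := by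
  by_cases hk : k = 0
  · subst hk; simp [kl_hc_refl_zero]
  · rw [if_neg (reflMomentum_ne_zero hk), if_neg hk, kl_hc_cos_nat_mul, kl_hc_cos_nat_mul, kl_hc_arg_refl,
      neg_nsmul, Real.Angle.cos_neg]

/-- `sin (j · arg)` is odd under the axis reflection. [folklore] -/
theorem kl_hc_sin_refl (j : ℕ) (k : Momentum) :
    (if reflMomentum k = 0 then (0 : ℝ) else Real.sin (j * Complex.arg ⟨reflMomentum k 0, reflMomentum k 1⟩)) =
      -(if k = 0 then (0 : ℝ) else Real.sin (j * Complex.arg ⟨k 0, k 1⟩)) := by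
  by_cases hk : k = 0
  · subst hk; simp [kl_hc_refl_zero]
  · rw [if_neg (reflMomentum_ne_zero hk), if_neg hk, kl_hc_sin_nat_mul, kl_hc_sin_nat_mul, kl_hc_arg_refl,
      neg_nsmul, Real.Angle.sin_neg]

/-- `cos (j · arg)` is odd under `k ↦ -k` for odd `j`. [folklore] -/
theorem kl_hc_cos_neg_odd {j : ℕ} (hj : j % 2 = 1) (k : Momentum) :
    (if -k = 0 then (0 : ℝ) else Real.cos (j * Complex.arg ⟨(-k) 0, (-k) 1⟩)) =
      -(if k = 0 then (0 : ℝ) else Real.cos (j * Complex.arg ⟨k 0, k 1⟩)) := by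
  by_cases hk : k = 0
  · subst hk; simp
  · rw [if_neg (neg_ne_zero.2 hk), if_neg hk, kl_hc_cos_nat_mul, kl_hc_cos_nat_mul, kl_hc_arg_neg hk,
      nsmul_add, kl_hc_nsmul_pi_of_odd hj, Real.Angle.cos_add_pi]

/-- `sin (j · arg)` is odd under `k ↦ -k` for odd `j`. [folklore] -/
theorem kl_hc_sin_neg_odd {j : ℕ} (hj : j % 2 = 1) (k : Momentum) :
    (if -k = 0 then (0 : ℝ) else Real.sin (j * Complex.arg ⟨(-k) 0, (-k) 1⟩)) =
      -(if k = 0 then (0 : ℝ) else Real.sin (j * Complex.arg ⟨k 0, k 1⟩)) := by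
  by_cases hk : k = 0
  · subst hk; simp
  · rw [if_neg (neg_ne_zero.2 hk), if_neg hk, kl_hc_sin_nat_mul, kl_hc_sin_nat_mul, kl_hc_arg_neg hk,
      nsmul_add, kl_hc_nsmul_pi_of_odd hj, Real.Angle.sin_add_pi]

/-! ### The registered statement -/

/-- **Angle harmonics are channel functions.** With the polar angle `arg k := Complex.arg (k₀ + i k₁)` and the value
`0` at the origin, `cos (j·arg k)` lies in `A1g` for `j ≡ 0 (4)`, in `B1g` for `j ≡ 2 (4)`, in `E` for odd `j`;
`sin (j·arg k)` lies in `A2g` for `j ≡ 0 (4)`, in `B2g` for `j ≡ 2 (4)`, in `E` for odd `j`; and channels are linear.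
[folklore] -/
theorem stub_klHarmonicChannel :
    (∀ (χ : D4Irrep) (f g : Momentum → ℝ) (a b : ℝ), InChannel χ f → InChannel χ g →
      InChannel χ (fun k => a * f k + b * g k)) ∧
    ∀ j : ℕ,
      (j % 4 = 0 → InChannel D4Irrep.A1g
        (fun k : Momentum => if k = 0 then 0 else Real.cos (j * Complex.arg ⟨k 0, k 1⟩))) ∧
      (j % 4 = 0 → InChannel D4Irrep.A2g
        (fun k : Momentum => if k = 0 then 0 else Real.sin (j * Complex.arg ⟨k 0, k 1⟩))) ∧
      (j % 4 = 2 → InChannel D4Irrep.B1g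
        (fun k : Momentum => if k = 0 then 0 else Real.cos (j * Complex.arg ⟨k 0, k 1⟩))) ∧
      (j % 4 = 2 → InChannel D4Irrep.B2g
        (fun k : Momentum => if k = 0 then 0 else Real.sin (j * Complex.arg ⟨k 0, k 1⟩))) ∧
      (j % 2 = 1 → InChannel D4Irrep.E
        (fun k : Momentum => if k = 0 then 0 else Real.cos (j * Complex.arg ⟨k 0, k 1⟩)) ∧
        InChannel D4Irrep.E
        (fun k : Momentum => if k = 0 then 0 else Real.sin (j * Complex.arg ⟨k 0, k 1⟩))) := by
  refine ⟨kl_hc_inChannel_linear, fun j => ⟨fun hj => ?_, fun hj => ?_, fun hj => ?_, fun hj => ?_,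
    fun hj => ⟨?_, ?_⟩⟩⟩
  · refine kl_hc_inChannel_A1g_of ?_ ?_
    · exact fun k => kl_hc_cos_rot_mod_zero hj k
    · exact fun k => kl_hc_cos_refl j k
  · refine kl_hc_inChannel_A2g_of ?_ ?_
    · exact fun k => kl_hc_sin_rot_mod_zero hj k
    · exact fun k => kl_hc_sin_refl j k
  · refine kl_hc_inChannel_B1g_of ?_ ?_
    · exact fun k => kl_hc_cos_rot_mod_two hj k
    · exact fun k => kl_hc_cos_refl j k
  · refine kl_hc_inChannel_B2g_of ?_ ?_
    · exact fun k => kl_hc_sin_rot_mod_two hj k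
    · exact fun k => kl_hc_sin_refl j k
  · exact (inChannel_E_iff_odd _).2 fun k => kl_hc_cos_neg_odd hj k
  · exact (inChannel_E_iff_odd _).2 fun k => kl_hc_sin_neg_odd hj k

end Summit.HubbardSuperconductivity.HubbardSuperconductivity.Theorems

end
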